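import Summits.MatrixMultiplication.OmegaCensus.ThreeSetLineCertificate
import HarnessLib

/-!
# Inverse certificates for the three-set line identity: an in-kernel decision procedure (no certificate tables)

ω-census `pub-omega`, family (b3), seat pub-omega-group gen 39.  Framing: lottery ticket; floor = certified bounds/negative
ranges.  VALUE: a reusable kernel tool for the three-set cube cells of the Dih-side `|A| ≡ 1 (mod 3)` classification over
`A = ℤ_p²` (cells `(4,4,6)@289`, `(4,5,6)@361`, `(4,4,11)@529`, …); NOT progress on ω.

Setting (`ThreeSetLineCertificate`).  A cube symmetric form pushed along `φ : A ↠ ℤ_q` gives count vectors `W, F, G` and a hole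
`s` with `Σ_u M(τ,u)·G(u) + [s = τ] = K` for all `τ` (`M = lineMat3 W F`, `K = |ker φ|`).  The modular Farkas certificates
of gen 36 (`lineCert3At`) need a TABLE entry per line datum.  Here the line datum `(W, F)` is REFUTED IN THE KERNEL without data:
* `LineInv.noSol3Chk q N ζ K e W F` (a `Bool`, pure `ℕ` list arithmetic): computes a candidate inverse `B` of `M` modulo a prime
  `N` (UNVERIFIED — block-diagonalisation of the circulant-plus-Hankel matrix `M` by a discrete Fourier transform with a `q`-th
  root of unity `ζ mod N`), CHECKS `B·M ≡ I (mod N)`, and then for every hole `s` forms the unique residue solution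
  `y_s ≡ B·(K·𝟙 − e_s)`; the hole is refuted when some `y_s(i) > e` or `M·y_s ≠ K·𝟙 − e_s` over `ℕ`.
* **`LineInv.noSol3Chk_sound`**: if the check passes then NO `G : ZMod q → ℕ` with all `G(u) ≤ e` and no hole `s` satisfy the
  three-set line identity with constant `K` (any genuine solution is `≡ y_s (mod N)` by `B·M ≡ I`, and `0 ≤ G ≤ e < N` pins it
  to `y_s`).  In the census application `e = |Y|` (indeed `ΣG = |Y|` is forced) and `K = |A|/q`.
Only the CHECKED facts (`B·M ≡ I`, the per-hole tests) enter the proof; how `B` was found is irrelevant.  Cost per line datum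
at `q = 17`: ≈ 0.8 s of kernel time (gen-39 measurement), versus no tool at all for these data before.
-/

namespace Summit.MatrixMultiplication.OmegaCensus

open Finset

namespace LineInv

/-! ## The checker (pure `ℕ`, lists) -/

/-- `Σ aᵢbᵢ` over two lists (truncating at the shorter). [folklore] -/
def dot : List ℕ → List ℕ → ℕ
  | a :: as, b :: bs => a * b + dot as bs
  | _, _ => 0

/-- The circulant symbol `A(t) = Σ_v W(v)·(F(t+v) + F(v−t))` of the three-set line matrix. [folklore] -/
def acoef (q : ℕ) (W F : List ℕ) : List ℕ :=
  (List.range q).map fun t => ((List.range q).map fun v =>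
    W.getD v 0 * (F.getD ((t + v) % q) 0 + F.getD ((v + q - t) % q) 0)).sum

/-- The Hankel symbol `C(t) = Σ_v W(v)·F(t−v)` of the three-set line matrix. [folklore] -/
def ccoef (q : ℕ) (W F : List ℕ) : List ℕ :=
  (List.range q).map fun t => ((List.range q).map fun v => W.getD v 0 * F.getD ((t + q - v) % q) 0).sum

/-- The line matrix entry `M(τ,u) = A(τ−u) + C(τ+u)` (indices as naturals `< q`). [folklore] -/
def mfun (q : ℕ) (W F : List ℕ) (τ u : ℕ) : ℕ :=
  (acoef q W F).getD ((τ + q - u) % q) 0 + (ccoef q W F).getD ((τ + u) % q) 0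

/-- The rows of the line matrix. [folklore] -/
def rows (q : ℕ) (W F : List ℕ) : List (List ℕ) :=
  (List.range q).map fun τ => (List.range q).map fun u => mfun q W F τ u

/-- The columns of the line matrix. [folklore] -/
def cols (q : ℕ) (W F : List ℕ) : List (List ℕ) :=
  (List.range q).map fun u => (List.range q).map fun τ => mfun q W F τ u

/-- Powers `ζ^k mod N`, `k < q`. [folklore] -/
def zpows (q N ζ : ℕ) : List ℕ := (List.range q).map fun k => ζ ^ k % N

/-- Discrete Fourier transform mod `N`: `v̂(k) = Σ_u v(u) ζ^{ku}`. [folklore] -/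
def dft (q N : ℕ) (zp : List ℕ) (v : List ℕ) : List ℕ :=
  (List.range q).map fun k => ((List.range q).map fun u => v.getD u 0 * zp.getD (k * u % q) 0).sum % N

/-- Inverse modulo a prime `N` by Fermat. [folklore] -/
def invN (N a : ℕ) : ℕ := a ^ (N - 2) % N

/-- UNVERIFIED candidate inverse of the line matrix mod `N`: the matrix is `circulant(A) + hankel(C)`, the DFT splits it into
`2 × 2` blocks `[[Â(k), Ĉ(k)], [Ĉ(−k), Â(−k)]]`, whose inverses are again of that shape; transform back.  Only the CHECK
`invChk` of the result is used in proofs. [folklore] -/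
def invCand (q N ζ : ℕ) (W F : List ℕ) : List (List ℕ) :=
  let zp := zpows q N ζ
  let wh := dft q N zp W
  let xh := dft q N zp F
  let neg := fun k : ℕ => (q - k) % q
  let Ah := (List.range q).map fun k => (wh.getD (neg k) 0 * xh.getD k 0 + wh.getD k 0 * xh.getD (neg k) 0) % N
  let Ch := (List.range q).map fun k => (wh.getD k 0 * xh.getD k 0) % N
  let dt := fun k : ℕ => (Ah.getD k 0 * Ah.getD (neg k) 0 + N * N - Ch.getD k 0 * Ch.getD (neg k) 0) % N
  let Ap := (List.range q).map fun k =>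
    if k = 0 then invN N ((Ah.getD 0 0 + Ch.getD 0 0) % N) else (Ah.getD (neg k) 0 * invN N (dt k)) % N
  let Cp := (List.range q).map fun k => if k = 0 then 0 else ((N - Ch.getD k 0) * invN N (dt k)) % N
  let qi := invN N (q % N)
  let Apr := (List.range q).map fun t => (qi * ((List.range q).map fun k => Ap.getD k 0 * zp.getD (neg k * t % q) 0).sum) % N
  let Cpr := (List.range q).map fun t => (qi * ((List.range q).map fun k => Cp.getD k 0 * zp.getD (neg k * t % q) 0).sum) % N
  (List.range q).map fun i => (List.range q).map fun r => (Apr.getD ((i + q - r) % q) 0 + Cpr.getD ((i + r) % q) 0) % N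

/-- Right-hand side `b_s(r) = K − [r = s]`. [folklore] -/
def bvec (q K s : ℕ) : List ℕ := (List.range q).map fun r => if r = s then K - 1 else K

/-- Check `B·M ≡ I (mod N)`. [folklore] -/
def invChk (q N : ℕ) (B C : List (List ℕ)) : Bool :=
  (List.range q).all fun i => (List.range q).all fun j =>
    dot (B.getD i []) (C.getD j []) % N == (if i = j then 1 % N else 0)

/-- Row sums of `B` mod `N`. [folklore] -/
def rowSums (N : ℕ) (B : List (List ℕ)) : List ℕ := B.map fun row => row.sum % N

/-- The candidate solution for hole `s`: `y_s(i) ≡ (B b_s)(i) = K·Σ_r B(i,r) − B(i,s)  (mod N)`, reduced. [folklore] -/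
def ycand (q N K : ℕ) (B : List (List ℕ)) (R : List ℕ) (s : ℕ) : List ℕ :=
  (List.range q).map fun i => (K * R.getD i 0 + (N - (B.getD i []).getD s 0 % N)) % N

/-- Hole `s` is refuted: the residue solution has an entry `> e`, or it does not solve the system over `ℕ`. [folklore] -/
def holeRefuted (q N K e : ℕ) (M B : List (List ℕ)) (R : List ℕ) (s : ℕ) : Bool :=
  let y := ycand q N K B R s
  (y.any fun v => decide (e < v)) || !((List.range q).all fun r => dot (M.getD r []) y == (bvec q K s).getD r 0)

/-- **The inverse certificate check** for the three-set line data `(W, F)` over `ℤ_q` at fibre size `K` with `Y`-entries `≤ e`: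
`e < N`, the candidate `B` inverts `M` mod `N`, and every hole position is refuted. [folklore] -/
def noSol3Chk (q N ζ K e : ℕ) (W F : List ℕ) : Bool :=
  let M := rows q W F
  let C := cols q W F
  let B := invCand q N ζ W F
  let R := rowSums N B
  decide (e < N) && invChk q N B C && (List.range q).all fun s => holeRefuted q N K e M B R s

/-! ## List / `Finset` bridges -/

/-- Reading an entry of a `map` over `range`. [folklore] -/
theorem getD_range_map {α : Type*} (f : ℕ → α) {n i : ℕ} (hi : i < n) (d : α) :
    ((List.range n).map f).getD i d = f i := by
  simp [List.getD_eq_getElem?_getD, List.getElem?_range hi]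

/-- A list `map`ped over `range` sums to the `Finset.range` sum. [folklore] -/
theorem sum_range_map (n : ℕ) (f : ℕ → ℕ) : ((List.range n).map f).sum = ∑ i ∈ Finset.range n, f i := by
  induction n with
  | zero => rfl
  | succ n ih => rw [List.range_succ, List.map_append, List.sum_append, ih, Finset.sum_range_succ]; simp

/-- `dot l (map f (range n)) = Σ_{r<n} l[r]·f(r)` (entries beyond the end of `l` read as `0`). [folklore] -/
theorem dot_range_map (l : List ℕ) (n : ℕ) (f : ℕ → ℕ) :
    dot l ((List.range n).map f) = ∑ r ∈ Finset.range n, l.getD r 0 * f r := by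
  induction n generalizing l f with
  | zero => cases l <;> rfl
  | succ n ih =>
    rw [List.range_succ_eq_map, List.map_cons, List.map_map, Finset.sum_range_succ']
    cases l with
    | nil => simp [dot]
    | cons a l =>
      show a * f 0 + dot l ((List.range n).map (f ∘ Nat.succ)) = _
      rw [ih l (f ∘ Nat.succ), add_comm]
      rfl

/-- The sum of a list is the sum of its entries read by `getD`. [folklore] -/
theorem sum_eq_sum_getD (l : List ℕ) : l.sum = ∑ r ∈ Finset.range l.length, l.getD r 0 := by
  induction l with
  | nil => rfl
  | cons a l ih => rw [List.sum_cons, List.length_cons, Finset.sum_range_succ', ih, add_comm]; rfl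

/-- Membership in a `map` over `range`. [folklore] -/
theorem mem_range_map {α : Type*} {f : ℕ → α} {n : ℕ} {a : α} (h : a ∈ (List.range n).map f) : ∃ i < n, f i = a := by
  obtain ⟨i, hi, rfl⟩ := List.mem_map.1 h
  exact ⟨i, List.mem_range.1 hi, rfl⟩

/-! ## `ZMod` index bridges -/

section ZModBridge

variable {q : ℕ} [NeZero q]

/-- `(a − b).val = (a.val + q − b.val) mod q`. [folklore] -/
theorem val_sub_eq (a b : ZMod q) : (a - b).val = (a.val + q - b.val) % q := by
  have hb : b.val ≤ a.val + q := (ZMod.val_lt b).le.trans (Nat.le_add_left q a.val)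
  have hc : ((a.val + q - b.val : ℕ) : ZMod q) = a - b := by
    rw [Nat.cast_sub hb]; push_cast; rw [ZMod.natCast_zmod_val, ZMod.natCast_zmod_val, ZMod.natCast_self]; ring
  rw [← hc, ZMod.val_natCast]

/-- `(a + b).val = (a.val + b.val) mod q`. [folklore] -/
theorem val_add_eq (a b : ZMod q) : (a + b).val = (a.val + b.val) % q := ZMod.val_add a b

/-- Summing over `ZMod q` is summing over `range q`. [folklore] -/
theorem sum_zmod_val (g : ℕ → ℕ) : ∑ v : ZMod q, g v.val = ∑ i ∈ Finset.range q, g i := by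
  obtain ⟨n, hn⟩ : ∃ n, q = n + 1 := ⟨q - 1, (Nat.succ_pred_eq_of_pos (Nat.pos_of_ne_zero (NeZero.ne q))).symm⟩
  subst hn
  exact Fin.sum_univ_eq_sum_range (fun i => g i) (n + 1)

/-- **Bridge**: the `ZMod`-indexed `lineMat3` of list data is the pure-`ℕ` `mfun`. [folklore] -/
theorem lineMat3_eq_mfun (W F : List ℕ) (τ u : ZMod q) :
    lineMat3 (vecFn W) (vecFn F) τ u = mfun q W F τ.val u.val := by
  have hτ := ZMod.val_lt τ
  have hu := ZMod.val_lt u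
  have ht : (τ.val + q - u.val) % q < q := Nat.mod_lt _ (Nat.pos_of_ne_zero (NeZero.ne q))
  have ht' : (τ.val + u.val) % q < q := Nat.mod_lt _ (Nat.pos_of_ne_zero (NeZero.ne q))
  unfold mfun acoef ccoef
  rw [getD_range_map _ ht, getD_range_map _ ht', sum_range_map, sum_range_map, ← Finset.sum_add_distrib]
  unfold lineMat3 vecFn
  set gfn : ℕ → ℕ := fun n => W.getD n 0 * (F.getD (((τ.val + q - u.val) % q + n) % q) 0 +
      F.getD ((n + q - (τ.val + q - u.val) % q) % q) 0) + W.getD n 0 * F.getD (((τ.val + u.val) % q + q - n) % q) 0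
    with hgfn
  have key : ∀ v : ZMod q, W.getD v.val 0 * (F.getD (τ - u + v).val 0 + F.getD (v + u - τ).val 0 +
      F.getD (τ + u - v).val 0) = gfn v.val := by
    intro v
    have i1 : (τ - u + v).val = ((τ.val + q - u.val) % q + v.val) % q := by rw [val_add_eq, val_sub_eq]
    have i2 : (v + u - τ).val = (v.val + q - (τ.val + q - u.val) % q) % q := by
      rw [show v + u - τ = v - (τ - u) by ring, val_sub_eq, val_sub_eq]
    have i3 : (τ + u - v).val = ((τ.val + u.val) % q + q - v.val) % q := by rw [val_sub_eq, val_add_eq]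
    simp only [i1, i2, i3, hgfn]; ring
  rw [Finset.sum_congr rfl fun v _ => key v, sum_zmod_val gfn]

end ZModBridge

/-! ## Soundness -/

section Sound

variable {q : ℕ} [NeZero q]

/-- The `ZMod`-form sum in `lineMat3_eq_mfun`'s statement, re-indexed: for `τ : ZMod q`,
`Σ_{u : ZMod q} lineMat3 τ u · G u = Σ_{u<q} mfun τ.val u · G(u)`. [folklore] -/
theorem sum_lineMat3_eq (W F : List ℕ) (G : ZMod q → ℕ) (τ : ZMod q) :
    ∑ u : ZMod q, lineMat3 (vecFn W) (vecFn F) τ u * G u =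
      ∑ u ∈ Finset.range q, mfun q W F τ.val u * G (u : ZMod q) := by
  rw [← sum_zmod_val (fun u => mfun q W F τ.val u * G (u : ZMod q))]
  exact Finset.sum_congr rfl fun u _ => by rw [lineMat3_eq_mfun, ZMod.natCast_zmod_val]

/-- Arithmetic of the residue solution: `(K·(S mod N) + (N − b mod N)) ≡ K·S − b (mod N)` for `b ≤ S`, `1 ≤ K`. [folklore] -/
theorem ycand_congr {K S b N : ℕ} (hb : b ≤ S) (hK : 1 ≤ K) (hN : 0 < N) :
    (K * (S % N) + (N - b % N)) % N = (K * S - b) % N := by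
  have hbKS : b ≤ K * S := hb.trans (Nat.le_mul_of_pos_left S hK)
  have hbm : b % N ≤ N := (Nat.mod_lt _ hN).le
  have h1 : (K * (S % N) + (N - b % N) + b) % N = (K * S) % N := by
    have e1 : K * (S % N) + (N - b % N) + b = K * (S % N) + N + (b - b % N) := by
      have := Nat.mod_le b N; omega
    rw [e1, Nat.add_mod, Nat.add_mod (K * (S % N)), Nat.mod_self, add_zero, Nat.mod_mod,
      show (b - b % N) % N = 0 from Nat.sub_mod_eq_zero_of_mod_eq (Nat.mod_mod _ _).symm, add_zero, Nat.mod_mod,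
      Nat.mul_mod, Nat.mod_mod, ← Nat.mul_mod]
  have h2 : (K * S - b + b) % N = (K * S) % N := by rw [Nat.sub_add_cancel hbKS]
  exact Nat.ModEq.add_right_cancel' b (h1.trans h2.symm)

/-- Reading a row sum. [folklore] -/
theorem getD_rowSums (B : List (List ℕ)) (N i : ℕ) (hi : i < B.length) :
    (rowSums N B).getD i 0 = (B.getD i []).sum % N := by
  unfold rowSums
  rw [List.getD_eq_getElem?_getD, List.getElem?_map, List.getD_eq_getElem?_getD, List.getElem?_eq_getElem hi]
  rfl

/-- **Soundness of the inverse certificate.**  If `noSol3Chk q N ζ K e W F` passes, then no `G : ZMod q → ℕ` with all entries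
`≤ e` and no hole `s` satisfy the three-set line identity `Σ_u M(τ,u)·G(u) + [s = τ] = K` for the list data `W, F`. [folklore] -/
theorem noSol3Chk_sound {N ζ K e : ℕ} {W F : List ℕ} (h : noSol3Chk q N ζ K e W F = true)
    (G : ZMod q → ℕ) (s : ZMod q) (hG : ∀ u, G u ≤ e)
    (hid : ∀ τ : ZMod q, (∑ u : ZMod q, lineMat3 (vecFn W) (vecFn F) τ u * G u) + (if s = τ then 1 else 0) = K) :
    False := by
  have hq : 0 < q := Nat.pos_of_ne_zero (NeZero.ne q)
  -- unpack the check
  unfold noSol3Chk at h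
  simp only [Bool.and_eq_true, decide_eq_true_eq, List.all_eq_true, List.mem_range] at h
  obtain ⟨⟨heN, hinv⟩, hholes⟩ := h
  set B := invCand q N ζ W F with hB
  set R := rowSums N B with hR
  have hNpos : 0 < N := by omega
  -- notation: `g u = G ↑u`, the hole index `sv`, and `K = K' + 1`
  have hgle : ∀ u : ℕ, G (u : ZMod q) ≤ e := fun u => hG _
  set sv := s.val with hsv
  have hsv_lt : sv < q := ZMod.val_lt s
  have hK1 : 1 ≤ K := by have := hid s; simp at this; omega
  obtain ⟨K', rfl⟩ : ∃ K', K = K' + 1 := ⟨K - 1, by omega⟩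
  -- (1) the system in pure-ℕ form
  have hsys : ∀ r, r < q → ∑ u ∈ Finset.range q, mfun q W F r u * G (u : ZMod q) = (if r = sv then K' else K' + 1) := by
    intro r hr
    have h0 := hid (r : ZMod q)
    rw [sum_lineMat3_eq, ZMod.val_natCast, Nat.mod_eq_of_lt hr] at h0
    have hiff : (s = (r : ZMod q)) ↔ r = sv := by
      constructor
      · intro e; rw [hsv, e, ZMod.val_natCast, Nat.mod_eq_of_lt hr]
      · intro e; rw [e, hsv, ZMod.natCast_zmod_val]
    by_cases hrs : r = sv
    · rw [if_pos (hiff.2 hrs)] at h0; rw [if_pos hrs]; omega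
    · rw [if_neg (fun e => hrs (hiff.1 e))] at h0; rw [if_neg hrs]; omega
  -- (2) `B·M ≡ I (mod N)` in pure-ℕ form
  have hcols : ∀ j, j < q → (cols q W F).getD j [] = (List.range q).map fun r => mfun q W F r j :=
    fun j hj => by unfold cols; rw [getD_range_map _ hj]
  have hBM : ∀ i j, i < q → j < q →
      (∑ r ∈ Finset.range q, (B.getD i []).getD r 0 * mfun q W F r j) % N = if i = j then 1 % N else 0 := by
    intro i j hi hj
    have h0 := hinv
    unfold invChk at h0
    simp only [List.all_eq_true, List.mem_range, beq_iff_eq] at h0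
    have h1 := h0 i hi j hj
    rw [hcols j hj, dot_range_map] at h1
    exact h1
  -- (3) the residue solution equals `G`
  have hBlen : B.length = q := by simp [hB, invCand]
  have hBrow : ∀ i, i < q → (B.getD i []).length = q := by
    intro i hi
    simp only [hB, invCand]
    rw [getD_range_map _ hi]; simp
  have hRi : ∀ i, i < q → R.getD i 0 = (∑ r ∈ Finset.range q, (B.getD i []).getD r 0) % N := by
    intro i hi
    rw [hR, getD_rowSums B N i (by rw [hBlen]; exact hi), sum_eq_sum_getD, hBrow i hi]
  have hyc : ∀ i, i < q → ((K' + 1) * R.getD i 0 + (N - (B.getD i []).getD sv 0 % N)) % N = G (i : ZMod q) := by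
    intro i hi
    set Bi := B.getD i [] with hBi
    set S := ∑ r ∈ Finset.range q, Bi.getD r 0 with hS
    have hb : Bi.getD sv 0 ≤ S := Finset.single_le_sum (f := fun r => Bi.getD r 0) (fun _ _ => Nat.zero_le _)
      (Finset.mem_range.2 hsv_lt)
    rw [hRi i hi, ycand_congr hb (Nat.succ_le_succ (Nat.zero_le K')) hNpos]
    -- `K·S − Bi[sv] = Σ_r Bi[r]·b(r) = Σ_r Bi[r]·Σ_u M(r,u) G(u)`
    have e1 : (K' + 1) * S - Bi.getD sv 0 = ∑ r ∈ Finset.range q, Bi.getD r 0 * (if r = sv then K' else K' + 1) := by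
      have h2 : ∑ r ∈ Finset.range q, Bi.getD r 0 * (if r = sv then K' else K' + 1) + Bi.getD sv 0 = (K' + 1) * S := by
        rw [hS, Finset.mul_sum, ← Finset.sum_erase_add _ _ (Finset.mem_range.2 hsv_lt),
          ← Finset.sum_erase_add (Finset.range q) _ (Finset.mem_range.2 hsv_lt), if_pos rfl, add_assoc]
        congr 1
        · exact Finset.sum_congr rfl fun r hr => by rw [if_neg (Finset.ne_of_mem_erase hr)]; ring
        · ring
      omega
    rw [e1]
    have e2 : ∑ r ∈ Finset.range q, Bi.getD r 0 * (if r = sv then K' else K' + 1) =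
        ∑ u ∈ Finset.range q, G (u : ZMod q) * ∑ r ∈ Finset.range q, Bi.getD r 0 * mfun q W F r u := by
      rw [Finset.sum_congr rfl fun r hr => by rw [← hsys r (Finset.mem_range.1 hr), Finset.mul_sum], Finset.sum_comm]
      exact Finset.sum_congr rfl fun u _ => by rw [Finset.mul_sum]; exact Finset.sum_congr rfl fun r _ => by ring
    rw [e2, Finset.sum_nat_mod, Finset.sum_congr rfl fun u hu => by
      rw [Nat.mul_mod, hBM i u hi (Finset.mem_range.1 hu)]]
    rw [← Finset.sum_nat_mod]
    have e3 : ∑ u ∈ Finset.range q, G (u : ZMod q) % N * (if i = u then 1 % N else 0) = G (i : ZMod q) % N * (1 % N) := by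
      rw [Finset.sum_eq_single i (fun u _ hui => by rw [if_neg (Ne.symm hui), mul_zero])
        (fun hi' => absurd (Finset.mem_range.2 hi) hi'), if_pos rfl]
    rw [e3, ← Nat.mul_mod, mul_one, Nat.mod_eq_of_lt (lt_of_le_of_lt (hgle i) heN)]
  -- (4) the hole `sv` is refuted — contradiction
  have hh := hholes sv hsv_lt
  have hyfun : ∀ i, i < q → (ycand q N (K' + 1) B R sv).getD i 0 = G (i : ZMod q) := by
    intro i hi; unfold ycand; rw [getD_range_map _ hi]; exact hyc i hi
  have hall : ((List.range q).all fun r =>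
      dot ((rows q W F).getD r []) (ycand q N (K' + 1) B R sv) == (bvec q (K' + 1) sv).getD r 0) = true := by
    rw [List.all_eq_true]
    intro r hr
    rw [List.mem_range] at hr
    rw [beq_iff_eq]
    unfold rows bvec
    rw [getD_range_map _ hr, getD_range_map _ hr, Nat.add_sub_cancel]
    unfold ycand
    rw [dot_range_map, ← hsys r hr]
    refine Finset.sum_congr rfl fun u hu => ?_
    rw [getD_range_map _ (Finset.mem_range.1 hu), hyc u (Finset.mem_range.1 hu)]
  have hany : ((ycand q N (K' + 1) B R sv).any fun v => decide (e < v)) = false := by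
    rw [List.any_eq_false]
    intro v hv
    unfold ycand at hv
    obtain ⟨i, hi, rfl⟩ := mem_range_map hv
    rw [decide_eq_true_eq, not_lt, hyc i hi]
    exact hgle i
  unfold holeRefuted at hh
  dsimp only at hh
  rw [hany, hall] at hh
  exact Bool.noConfusion hh

end Sound

end LineInv

end Summit.MatrixMultiplication.OmegaCensus
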